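import Summits.AtomisticToContinuum.Crystallization.Theorems.ChargedEnergyGapLocalTransfer
import Literature.MathematicalPhysics.StatisticalMechanics.PeriodicConfigurationSums
import HarnessLib

/-!
(SPLIT FOR THE 400-LINE CAP by the landing lane, hand-2 g31: this file = part 1 of 2; sequels `…ChargedEnergyGapRotationGauge` import it in a chain; same namespace, all FQNs unchanged.)
# `ChargedEnergyGap` — the ROTATION GAUGE (1/2): rotation cocycles, the VACUITY of the typed stability hypothesis, the collapse of the (H)-tower
# (cell `decomp-a2c`, lens 3, generation 61, node «RotationGauge», part P-I(1/2); over part P-D `…Theorems.ChargedEnergyGapLocalTransfer`)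

THE ALARM (memo g61 §0).  Every transfer bound of the lineage since generation 53 — (H♭) `HarmonicTransferBoundC`, (H), (H♯)
`VolterraTransferBoundC`, (Hˢ) `SeamTransferBoundC`, (H𝄪) `LocalSeamTransferBoundC` — assumes of its reference `P` the STABILITY MARGIN
`HarmStableWith μ₀ P : ∀ β, IsGlobalCocycle P β → μ₀·Σ_y dirichletSite β P y ≤ Σ_y quadSite β P ∅ y`, quantified over ALL global cocycles.
The bond field `β(y, z) = W(z − y)` of an infinitesimal ROTATION `W ∈ so(3)` (`rotField r₀ v`, `W = v ⊗ r₀ − r₀ ⊗ v`) is a global cocycle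
(`isGlobalCocycle_rotField`); on it the linear bond term vanishes and the quadratic bond term is the transverse tension part
`(V′(d)/d)·‖W(z − y)‖²` (`⟪ê, W r⟫ = 0`), so the cell's quadratic energy is `¼·tr(WᵀW·virial) = 0` at a STRESS-FREE reference
(`sum_quadSite_rotField_eq_zero`, after the summable split of the three virial sums; summability from the tree's
`PeriodicConfiguration.summable_inv_pow_dist`), while its Dirichlet energy is `≥ ‖W(z₀ − y₀)‖² > 0` for any bond `dist y₀ z₀ ≤ 2` and one
of the three coordinate rotations (`exists_rotField_single_ne_zero`).  HENCE ★★★ `harmStableWith_nonpos : IsStressFree P → HarmStableWith μ₀ P →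
(a bond ≤ 2) → μ₀ ≤ 0`, and every Barlow-labelled reference has such a bond (`IsLabelledRef.exists_short_bond`, `lam ≤ 9/11`, `ℓ ≥ 11/10`):
at every `μ₀ > 0` the hypothesis block `IsLabelledRef → … → IsStressFree → HarmStableWith μ₀ → …` is CONTRADICTORY.

THE COLLAPSE (§2).  ★★★ (H♭), (H), (H♯), (Hˢ), (H𝄪) are THEOREMS at every `μ₀ > 0`, `lam ≤ 9/11`, `ℓ ≥ 11/10` — for the wrong reason
(`C_H := 0`, ex falso): `localSeamTransferBoundC_of_pos`, `localSeamTransferBoundC_record` (the record's «open» transfer piece, TREE GEN 56L).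
★★★ Every reduction (N♭)/(N♯)/(Nˢ)/(N𝄪) `:= (H·) → leaf` is EQUIVALENT to the leaf `FarLabelledFloorCoredBudgetW` (`localSeamReductionW_iff_leaf`
&c.), so the record's open pair `(H𝄪) ∧ (N𝄪)` at `ϱ = 160` is ONE statement, the generation-52 budget far leaf
(`localSeamReductionW_record_iff_leaf`), and the ten-leaf cone of GEN 56L is the nine-leaf cone of GEN 52 with (H𝄪) discharged
(`chargedEnergyGap_of_maxCoverLocalLedger_collapsed`).  AS TYPED, generations 53–56 were costume splits `True ∧ (True → leaf)`.  What is NOT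
affected: the census engines (C10/C11/C13/C15/C16/χCOST) and memos, which always meant stability MODULO RIGID MOTIONS (affine strains and
periodic fields were tested; the skew affine fields — rotations — are the overlooked zero modes of the quadratic form at zero stress); the twin
programme of parts P-E…P-H (pure geometry, landed / landing); the leaf itself.

THE REPAIR is part P-I(2/2) `…Theorems.ChargedEnergyGapRotationRepair`: `HarmStableModRot μ₀ P` (the Dirichlet energy of `β` MINUS ITS BEST
ROTATION), the re-typed pair (H𝄪ʳ)/(N𝄪ʳ) — genuinely STRONGER / WEAKER than (H𝄪)/(N𝄪) — the rotation-gauged Dirichlet CREDIT form (H𝄪♯ʳ)(κ_D)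
asked for by critic row 1104 (c2)(i), the record cones, and the faceless-twist numbers (K-iv).

LESSON FOR THE TYPING CHECKLIST (proposed item (v)): a coercivity / stability hypothesis quantified over a LINEAR test space must be stated on
the QUOTIENT by the symmetry zero modes of the energy (here `so(3)`; translations are already invisible to bond fields) — else it is either
contradictory (equality-constrained references, as here) or silently restricts the references to a degenerate class.  The BC7 vacuity battery
cannot see this (it would have to construct a periodic configuration); generation 56's probe reported the piece CLEAN.

§1 Rotation cocycles: `rotField`, `gaugedField`, orthogonality, cocycle, `bondLin = 0`, `bondQuad` = tension part, `‖W r‖²` in virial products,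
summability (`summable_virial`, `summable_dirichlet_rotField`), ★★ `sum_quadSite_rotField_eq_zero`, Dirichlet lower bound, the moving coordinate
rotation.  §2 ★★★ the alarm, the short bond of Barlow-labelled references, (H♭)…(H𝄪) vacuously, the record instance, ★★★ the collapse iffs,
the collapsed record cone.

TAGS.  ALARM (vacuity, kernel-certified) · every theorem PROVED (no piece in this part) · imports P-D by its future tree name (seat files
g53 P-A … g56 P-D are not landed; checked in the tower `g61/check/Tower61.lean` = TowerG56 ++ this part ++ P-I(2/2)) and the landed
`Literature.…PeriodicConfigurationSums`. -/

noncomputable section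
open scoped Classical
open Literature.MathematicalPhysics.StatisticalMechanics
open Literature.Geometry.DiscreteGeometry
open Summit.AtomisticToContinuum.Crystallization.Theses.PricedLinkCensus
open Summit.AtomisticToContinuum.Crystallization.Theorems.ChargedEnergyGapNegative

namespace Summit.AtomisticToContinuum.Crystallization.Theorems.ChargedEnergyGapChartDial

/-! ## §1 Rotation cocycles -/

section Rotation

/-- The **ROTATION COCYCLE** generated by the pair `(r₀, v)`: `β(y, z) = ⟪z − y, r₀⟫·v − ⟪z − y, v⟫·r₀`, the bond field `W (z − y)` of the
skew linear map `W = v ⊗ r₀ − r₀ ⊗ v` (every infinitesimal rotation of `ℝ³` is of this form: axis `r₀ × v`). -/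
def rotField (r₀ v : E3) : E3 → E3 → E3 :=
  fun y z => inner ℝ (z - y) r₀ • v - inner ℝ (z - y) v • r₀

/-- A bond field minus a rotation cocycle: the ROTATION-GAUGED field. -/
def gaugedField (β : E3 → E3 → E3) (r₀ v : E3) : E3 → E3 → E3 :=
  fun y z => β y z - rotField r₀ v y z

/-- A rotation cocycle is orthogonal to its bond: `⟪z − y, W(z − y)⟫ = 0`. -/
theorem inner_rotField_self (r₀ v y z : E3) : inner ℝ (z - y) (rotField r₀ v y z) = 0 := by
  simp only [rotField, inner_sub_right, real_inner_smul_right]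
  ring

/-- … hence also to the unit bond vector of the model. -/
theorem inner_unit_rotField (r₀ v y z : E3) : inner ℝ ((dist y z)⁻¹ • (z - y)) (rotField r₀ v y z) = 0 := by
  rw [real_inner_smul_left, inner_rotField_self, mul_zero]

/-- ★ A rotation cocycle is a GLOBAL COCYCLE of every periodic configuration (antisymmetric, translation-invariant, additive on all triples)
— the fact the typed stability hypothesis `HarmStableWith` overlooks. -/
theorem isGlobalCocycle_rotField (P : PeriodicConfiguration 3) (r₀ v : E3) : IsGlobalCocycle P (rotField r₀ v) := by
  refine ⟨fun y _ z _ => ?_, fun g _ y z => ?_, fun y _ z _ x _ => ?_⟩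
  · have h : y - z = -(z - y) := by abel
    simp only [rotField, h, inner_neg_left, neg_smul]
    abel
  · simp only [rotField, add_sub_add_right_eq_sub]
  · have h : x - y = (z - y) + (x - z) := by abel
    simp only [rotField, h, inner_add_left, add_smul]
    abel

/-- The zero pair generates the zero field, so gauging by it changes nothing. -/
theorem rotField_zero (y z : E3) : rotField 0 0 y z = 0 := by
  simp [rotField]

/-- `gaugedField_zero` (docstring added by the landing lane; see the module docstring). [formal bookkeeping] -/
theorem gaugedField_zero (β : E3 → E3 → E3) : gaugedField β 0 0 = β := by
  funext y z
  simp [gaugedField, rotField]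

/-- Gauging a rotation cocycle by its own pair kills it. -/
theorem gaugedField_rotField_self (r₀ v : E3) : gaugedField (rotField r₀ v) r₀ v = fun _ _ => 0 := by
  funext y z
  simp [gaugedField]

/-- The LINEAR bond term vanishes on a rotation cocycle … -/
theorem bondLin_rotField (r₀ v y z : E3) : bondLin (rotField r₀ v) y z = 0 := by
  simp only [bondLin, inner_unit_rotField, mul_zero]

/-- … and the QUADRATIC bond term reduces to the transverse (tension) part `(V′(d)/d)·‖W(z − y)‖²`. -/
theorem bondQuad_rotField (r₀ v y z : E3) :
    bondQuad (rotField r₀ v) y z = ljD1 (dist y z) / dist y z * ‖rotField r₀ v y z‖ ^ 2 := by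
  simp only [bondQuad, inner_unit_rotField]
  ring

/-- `‖W(z − y)‖²` as a quadratic form in the bond vector: three virial-type products. -/
theorem norm_rotField_sq (r₀ v y z : E3) :
    ‖rotField r₀ v y z‖ ^ 2 =
      ‖v‖ ^ 2 * (inner ℝ (z - y) r₀ * inner ℝ (z - y) r₀) - 2 * inner ℝ v r₀ * (inner ℝ (z - y) r₀ * inner ℝ (z - y) v) +
        ‖r₀‖ ^ 2 * (inner ℝ (z - y) v * inner ℝ (z - y) v) := by
  simp only [rotField]
  rw [norm_sub_sq_real, norm_smul, norm_smul, real_inner_smul_left, real_inner_smul_right, Real.norm_eq_abs, Real.norm_eq_abs,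
    mul_pow, mul_pow, sq_abs, sq_abs]
  ring

/-- The virial-type summand `z ↦ (V′(d)/d)·⟪z − y, a⟫⟪z − y, b⟫` of `IsStressFree` is SUMMABLE over the points of a periodic configuration
(`|·| ≤ (d⁻¹² + d⁻⁶)·‖a‖‖b‖`, `PeriodicConfiguration.summable_inv_pow_dist`). -/
theorem summable_virial (P : PeriodicConfiguration 3) (y a b : E3) :
    Summable fun z : {z : E3 // z ∈ P.points ∧ z ≠ y} =>
      ljD1 (dist y z) / dist y (z : E3) * (inner ℝ ((z : E3) - y) a * inner ℝ ((z : E3) - y) b) := by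
  have h12 := P.summable_inv_pow_dist (show 3 < 12 by norm_num) y
  have h6 := P.summable_inv_pow_dist (show 3 < 6 by norm_num) y
  have hg : Summable fun z : {z : E3 // z ∈ P.points ∧ z ≠ y} =>
      ((dist y (z : E3))⁻¹ ^ 12 + (dist y (z : E3))⁻¹ ^ 6) * (‖a‖ * ‖b‖) := (h12.add h6).mul_right _
  refine Summable.of_norm_bounded hg fun z => ?_
  have hd : 0 < dist y (z : E3) := dist_pos.2 (fun h => z.2.2 h.symm)
  set d := dist y (z : E3) with hd_def
  have hr : ‖(z : E3) - y‖ = d := by rw [hd_def, dist_eq_norm, norm_sub_rev]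
  have ha : |inner ℝ ((z : E3) - y) a| ≤ d * ‖a‖ := hr ▸ abs_real_inner_le_norm _ _
  have hb : |inner ℝ ((z : E3) - y) b| ≤ d * ‖b‖ := hr ▸ abs_real_inner_le_norm _ _
  have hD : |ljD1 d| ≤ d⁻¹ ^ 13 + d⁻¹ ^ 7 := by
    unfold ljD1
    refine (abs_add_le _ _).trans ?_
    rw [abs_neg, abs_of_nonneg (by positivity), abs_of_nonneg (by positivity)]
  rw [Real.norm_eq_abs, abs_mul, abs_mul, abs_div, abs_of_pos hd]
  have hdi : d⁻¹ * d = 1 := inv_mul_cancel₀ hd.ne'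
  calc |ljD1 d| / d * (|inner ℝ ((z : E3) - y) a| * |inner ℝ ((z : E3) - y) b|)
      ≤ (d⁻¹ ^ 13 + d⁻¹ ^ 7) / d * (d * ‖a‖ * (d * ‖b‖)) := by gcongr
    _ = (d⁻¹ ^ 12 + d⁻¹ ^ 6) * (‖a‖ * ‖b‖) * (d⁻¹ * d) * (d⁻¹ * d) := by
        rw [div_eq_mul_inv]; ring
    _ = (d⁻¹ ^ 12 + d⁻¹ ^ 6) * (‖a‖ * ‖b‖) := by rw [hdi, mul_one, mul_one]

/-- Reindexing: with NO excised set the quadratic site term is a sum over all points `z ≠ y`. -/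
theorem quadSite_empty_eq (β : E3 → E3 → E3) (P : PeriodicConfiguration 3) (y : E3) :
    quadSite β P ∅ y = (1 / 4) * ∑' z : {z : E3 // z ∈ P.points ∧ z ≠ y}, bondQuad β y (z : E3) := by
  unfold quadSite
  congr 1
  let e : {z : E3 // z ∈ P.points ∧ z ∉ (∅ : Set E3) ∧ z ≠ y} ≃ {z : E3 // z ∈ P.points ∧ z ≠ y} :=
    Equiv.subtypeEquivRight fun z => by simp
  rw [← e.symm.tsum_eq]
  rfl

variable {P : PeriodicConfiguration 3}

/-- ★★ **At a STRESS-FREE reference the cell's quadratic energy VANISHES on every rotation cocycle**: after the summable split it is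
`¼·(‖v‖²·Σ(r₀,r₀) − 2⟪v,r₀⟫·Σ(r₀,v) + ‖r₀‖²·Σ(v,v))` in the three virial sums `Σ(a,b) = Σ_y Σ'_z (V′/d)⟪r,a⟫⟪r,b⟫ = 0` of `IsStressFree`. -/
theorem sum_quadSite_rotField_eq_zero (hS : IsStressFree P) (r₀ v : E3) :
    ∑ y ∈ P.motif, quadSite (rotField r₀ v) P ∅ y = 0 := by
  have key : ∀ y ∈ P.motif, quadSite (rotField r₀ v) P ∅ y =
      (1 / 4) * (‖v‖ ^ 2 * (∑' z : {z : E3 // z ∈ P.points ∧ z ≠ y},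
          ljD1 (dist y z) / dist y (z : E3) * (inner ℝ ((z : E3) - y) r₀ * inner ℝ ((z : E3) - y) r₀)) -
        2 * inner ℝ v r₀ * (∑' z : {z : E3 // z ∈ P.points ∧ z ≠ y},
          ljD1 (dist y z) / dist y (z : E3) * (inner ℝ ((z : E3) - y) r₀ * inner ℝ ((z : E3) - y) v)) +
        ‖r₀‖ ^ 2 * (∑' z : {z : E3 // z ∈ P.points ∧ z ≠ y},
          ljD1 (dist y z) / dist y (z : E3) * (inner ℝ ((z : E3) - y) v * inner ℝ ((z : E3) - y) v))) := by
    intro y _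
    rw [quadSite_empty_eq]
    congr 1
    have h1 := summable_virial P y r₀ r₀
    have h2 := summable_virial P y r₀ v
    have h3 := summable_virial P y v v
    rw [← tsum_mul_left, ← tsum_mul_left, ← tsum_mul_left, ← (h1.mul_left _).tsum_sub (h2.mul_left _),
      ← ((h1.mul_left _).sub (h2.mul_left _)).tsum_add (h3.mul_left _)]
    refine tsum_congr fun z => ?_
    rw [bondQuad_rotField, norm_rotField_sq]
    ring
  rw [Finset.sum_congr rfl key, ← Finset.mul_sum, Finset.sum_add_distrib, Finset.sum_sub_distrib, ← Finset.mul_sum, ← Finset.mul_sum,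
    ← Finset.mul_sum, hS r₀ r₀, hS r₀ v, hS v v]
  ring

/-- The LINEAR site term of a rotation cocycle vanishes identically (every bond term does), for every excised set. -/
theorem linSite_rotField (P : PeriodicConfiguration 3) (X : Set E3) (r₀ v y : E3) : linSite (rotField r₀ v) P X y = 0 := by
  simp [linSite, bondLin_rotField]

/-- The range-`2` Dirichlet summand of a rotation cocycle is summable (`‖W r‖² ≤ 4‖r₀‖²‖v‖²·d² ≤ 2¹⁶‖r₀‖²‖v‖²·d⁻¹²` on `d ≤ 2`). -/
theorem summable_dirichlet_rotField (P : PeriodicConfiguration 3) (r₀ v y : E3) :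
    Summable fun z : {z : E3 // z ∈ P.points ∧ z ≠ y ∧ dist y z ≤ 2} => ‖rotField r₀ v y (z : E3)‖ ^ 2 := by
  have h12 := P.summable_inv_pow_dist (show 3 < 12 by norm_num) y
  let ι : {z : E3 // z ∈ P.points ∧ z ≠ y ∧ dist y z ≤ 2} → {z : E3 // z ∈ P.points ∧ z ≠ y} :=
    fun z => ⟨z.1, z.2.1, z.2.2.1⟩
  have hι : Function.Injective ι := fun z z' h => Subtype.ext (by simpa [ι] using congrArg Subtype.val h)
  have hg : Summable fun z : {z : E3 // z ∈ P.points ∧ z ≠ y ∧ dist y z ≤ 2} =>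
      4 * 2 ^ 14 * (‖r₀‖ ^ 2 * ‖v‖ ^ 2) * (dist y (z : E3))⁻¹ ^ 12 := by
    have := (h12.comp_injective hι).mul_left (4 * 2 ^ 14 * (‖r₀‖ ^ 2 * ‖v‖ ^ 2))
    exact this.congr fun z => by simp [ι, Function.comp]
  refine Summable.of_nonneg_of_le (fun z => sq_nonneg _) (fun z => ?_) hg
  have hd : 0 < dist y (z : E3) := dist_pos.2 (fun h => z.2.2.1 h.symm)
  have hd2 : dist y (z : E3) ≤ 2 := z.2.2.2
  set d := dist y (z : E3) with hd_def
  have hr : ‖(z : E3) - y‖ = d := by rw [hd_def, dist_eq_norm, norm_sub_rev]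
  have ha : |inner ℝ ((z : E3) - y) r₀| ≤ d * ‖r₀‖ := hr ▸ abs_real_inner_le_norm _ _
  have hb : |inner ℝ ((z : E3) - y) v| ≤ d * ‖v‖ := hr ▸ abs_real_inner_le_norm _ _
  have hn : ‖rotField r₀ v y z‖ ≤ 2 * d * (‖r₀‖ * ‖v‖) := by
    unfold rotField
    refine (norm_sub_le _ _).trans ?_
    rw [norm_smul, norm_smul, Real.norm_eq_abs, Real.norm_eq_abs]
    nlinarith [norm_nonneg r₀, norm_nonneg v, abs_nonneg (inner ℝ ((z : E3) - y) r₀), abs_nonneg (inner ℝ ((z : E3) - y) v),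
      mul_le_mul_of_nonneg_right ha (norm_nonneg v), mul_le_mul_of_nonneg_right hb (norm_nonneg r₀)]
  have hsq : ‖rotField r₀ v y z‖ ^ 2 ≤ (2 * d * (‖r₀‖ * ‖v‖)) ^ 2 := pow_le_pow_left₀ (norm_nonneg _) hn 2
  have hpow : d ^ 2 ≤ 2 ^ 14 * d⁻¹ ^ 12 := by
    rw [inv_pow, ← div_eq_mul_inv, le_div_iff₀ (by positivity)]
    calc d ^ 2 * d ^ 12 = d ^ 14 := by ring
      _ ≤ 2 ^ 14 := pow_le_pow_left₀ hd.le hd2 14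
  calc ‖rotField r₀ v y z‖ ^ 2 ≤ (2 * d * (‖r₀‖ * ‖v‖)) ^ 2 := hsq
    _ = 4 * (‖r₀‖ ^ 2 * ‖v‖ ^ 2) * d ^ 2 := by ring
    _ ≤ 4 * (‖r₀‖ ^ 2 * ‖v‖ ^ 2) * (2 ^ 14 * d⁻¹ ^ 12) := by gcongr
    _ = 4 * 2 ^ 14 * (‖r₀‖ ^ 2 * ‖v‖ ^ 2) * d⁻¹ ^ 12 := by ring

/-- One bond of length `≤ 2` at a motif site bounds the cell's Dirichlet energy of a rotation cocycle from below by `‖W(z₀ − y₀)‖²`. -/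
theorem norm_sq_le_sum_dirichletSite_rotField (r₀ v : E3) {y₀ z₀ : E3} (hy₀ : y₀ ∈ P.motif) (hz₀ : z₀ ∈ P.points) (hne : z₀ ≠ y₀)
    (hd : dist y₀ z₀ ≤ 2) : ‖rotField r₀ v y₀ z₀‖ ^ 2 ≤ ∑ y ∈ P.motif, dirichletSite (rotField r₀ v) P y := by
  have h1 : ‖rotField r₀ v y₀ z₀‖ ^ 2 ≤ dirichletSite (rotField r₀ v) P y₀ := by
    unfold dirichletSite
    exact (summable_dirichlet_rotField P r₀ v y₀).le_tsum ⟨z₀, hz₀, hne, hd⟩ (fun z _ => sq_nonneg _)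
  exact h1.trans (Finset.single_le_sum (f := fun y => dirichletSite (rotField r₀ v) P y)
    (fun y _ => by unfold dirichletSite; exact tsum_nonneg fun _ => sq_nonneg _) hy₀)

/-- For a non-zero bond vector `z − y`, one of the three coordinate rotations `W_i = e_i ⊗ r − r ⊗ e_i` MOVES it (if all three vanished,
`‖r‖² = r_i²` for every `i`, so `3‖r‖² = ‖r‖²`). -/
theorem exists_rotField_single_ne_zero {y z : E3} (hne : z ≠ y) :
    ∃ i : Fin 3, rotField (z - y) (EuclideanSpace.single i 1) y z ≠ 0 := by
  by_contra h
  push Not at h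
  have hr0 : z - y ≠ 0 := sub_ne_zero.2 hne
  have hcoord : ∀ i : Fin 3, ‖z - y‖ ^ 2 = (z i - y i) * (z i - y i) := by
    intro i
    have hi := congrArg (fun w : E3 => w i) (h i)
    simp [rotField, EuclideanSpace.inner_single_right] at hi
    linarith
  have hsum : ‖z - y‖ ^ 2 = ∑ i : Fin 3, (z i - y i) * (z i - y i) := by
    rw [EuclideanSpace.norm_sq_eq]
    refine Finset.sum_congr rfl fun i _ => ?_
    rw [Real.norm_eq_abs, sq_abs, sq]
    simp
  rw [Fin.sum_univ_three, ← hcoord 0, ← hcoord 1, ← hcoord 2] at hsum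
  have : ‖z - y‖ ^ 2 = 0 := by linarith
  exact hr0 (by simpa using this)

end Rotation

end Summit.AtomisticToContinuum.Crystallization.Theorems.ChargedEnergyGapChartDial

end
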